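import Literature.NumberTheory.EllipticCurves.BSDSelmerParityDokchitserBaseChangeProofs
import Literature.NumberTheory.EllipticCurves.BSDSelmerPParityProofs
import Literature.NumberTheory.EllipticCurves.BSDHeegnerPointsSignEvenProofs
import HarnessLib

/-!
# Step (4) of the printed proof of the `p`-parity theorem over `ℚ`: twist form and converse

Sibling proof file of `Literature.NumberTheory.EllipticCurves.BSDSelmerParityDokchitserProofs`,
which states the named fact
`Literature.NumberTheory.EllipticCurves.dokchitser_selmerCorank_baseChange_mod_two_eq` — step (4)
of T. Dokchitser, V. Dokchitser, *On the Birch–Swinnerton-Dyer quotients modulo squares*, Ann. of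
Math. 172 (2010), §4.6, proof of Thm. 4.19 (= Thm. 1.4): for an elliptic curve `E/ℚ`, an odd
prime `p` and an imaginary quadratic field `M₀ = K` in which all bad primes of `E` split,
`rk_p(E/M₀) = corank_{ℤ_p} Sel_{p^∞}(E/M₀)` is odd — and of `BSDSelmerPParityProofs`, which
states the named fact `odd_analyticRankEK_of_satisfiesHeegnerHypothesis` (the sign of
`L(E/K, s)` is `−1` under the Heegner hypothesis: `ord_{s=1} L(E/K, s)` is odd; Darmon 2004,
§3.9). Nothing is asserted and no named fact is introduced (D-0014, D-0026); three theorems are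
PROVED:

* `dokchitser_selmerCorank_baseChange_mod_two_eq_iff_odd_add_quadraticTwist` — **the twist
  form of step (4)**: by the discharged Selmer-rank identity of a quadratic base change
  `rk_p(E/K) = rk_p(E/ℚ) + rk_p(E^{(d_K)}/ℚ)` (`selmerCorank_baseChange_quadratic_holds`,
  T. Dokchitser 2013, §4; mechanism Dokchitser–Dokchitser 2010, Lemma 4.14), step (4) is
  *equivalent* to: for every odd prime `p` and every Heegner field `K` of `E`,
  `rk_p(E/ℚ) + rk_p(E^{(d_K)}/ℚ)` is odd — the shape in which the parity of Selmer ranks under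
  quadratic twist is studied (Kramer 1981 for `p = 2`; Mazur–Rubin 2007);
* `odd_analyticRankEK_of_satisfiesHeegnerHypothesis_of_exists_isNewformOf` — **the named fact
  `odd_analyticRankEK_of_satisfiesHeegnerHypothesis` follows from the Modularity Theorem
  `exists_isNewformOf` alone** (Breuil–Conrad–Diamond–Taylor 2001, Thm. A, with Carayol 1986):
  the tree theorem `odd_analyticRankEK_of_isNewformOf_of_cuspCoeff_twist`
  (`BSDHeegnerPointsSignTwistProofs`: Atkin–Lehner and Hecke for the newform of `E` and its twist
  by the Kronecker character `χ_{d_K}`) fed with the Kronecker character supplied by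
  `exists_twistCharacter_of_odd_discr` / `exists_twistCharacter_of_four_dvd_discr`
  (`BSDHeegnerPointsSign{Odd,Even}Proofs`), exactly as the tree's
  `one_le_analyticRankEK_of_exists_isNewformOf` does for the weaker `ord ≥ 1`;
* `dokchitser_selmerCorank_baseChange_mod_two_eq_of_selmerCorank_mod_two_eq` — **the converse of
  the printed reduction "it suffices to prove it for `E/M₀`"**: Thm. 4.19 itself
  (`selmerCorank_mod_two_eq W p`: `rk_p(E/ℚ) ≡ ord_{s=1} L(E, s) (mod 2)`), granted for `E` and for
  its twist `E^{(d_K)}`, together with the Modularity Theorem, gives step (4) back: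
  `rk_p(E/K) = rk_p(E) + rk_p(E^{(d_K)}) ≡ ord L(E) + ord L(E^{(d_K)}) = ord L(E/K) ≡ 1 (mod 2)`
  (`analyticRankEK_eq_add_of`, `LeadingTermProofs`; the sign by the previous theorem). So, up
  to theorems of the tree and modularity, step (4) is *equivalent* to the `p`-parity theorem for
  the pair `(E, E^{(d_K)})`: the named fact is not stronger than Thm. 1.4, and it cannot be
  bypassed by anything weaker than the `p`-parity of quadratic twists by Heegner discriminants.

The discharge `dokchitser_selmerCorank_baseChange_mod_two_eq_holds` is NOT here: the printed
proof for `E/M₀` (anticyclotomic `ℤ_p`-tower, Lemma 4.14 for `D_{2p^{n+1}}`, Cor. 4.15,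
Prop. 4.17, Cornut–Vatsal Thm. 1.5/4.2 with Tian–Zhang / Nekovář Thm. 3.2) rests on leaves that
are not in the tree.

## References

* [DokchitserDokchitserAnnals2010] T. Dokchitser, V. Dokchitser, Ann. of Math. 172 (2010),
  567–596 = arXiv:math/0610290: §4.6, proof of Thm. 4.19 (= Thm. 1.4) (arXiv rendering: Thm. 52),
  and Lemma 4.14 (arXiv: Lemma 47).
* [Dokchitser2013ParityNotes] T. Dokchitser, *Notes on the parity conjecture*, CRM Barcelona,
  Birkhäuser (2013) = arXiv:1009.5389, §4.
* [Darmon2004] H. Darmon, *Rational points on modular elliptic curves*, CBMS 101 (2004), §3.6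
  (Thm. 3.15, Thm. 3.17) and §3.9 (proof of Thm. 3.22).
* [Gross1984] B. H. Gross, *Heegner points on `X₀(N)`*, in: Modular Forms (Durham 1983), §5.
* [BCDTJAMS2001] C. Breuil, B. Conrad, F. Diamond, R. Taylor, J. Amer. Math. Soc. 14 (2001), Thm. A.
-/

noncomputable section

open scoped Classical

open WeierstrassCurve Literature.NumberTheory.QuadraticFields
  Literature.NumberTheory.EllipticCurves.ModularForms

namespace Literature.NumberTheory.EllipticCurves

/-! ### The twist form of step (4) -/

/-- **Step (4) in twist form.** Since `rk_p(E/K) = rk_p(E/ℚ) + rk_p(E^{(d_K)}/ℚ)` for every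
quadratic field `K` and every prime `p` (`selmerCorank_baseChange_quadratic_holds`; T. Dokchitser
2013, §4, first display; Dokchitser–Dokchitser 2010, Lemma 4.14), the statement
"`rk_p(E/M₀)` is odd for every odd prime `p` and every imaginary quadratic `M₀` in which all bad
primes of `E` split" (Dokchitser–Dokchitser 2010, §4.6, proof of Thm. 4.19) is equivalent to
"`rk_p(E/ℚ) + rk_p(E^{(d_{M₀})}/ℚ)` is odd" for the same `p`, `M₀`.
[cite: DokchitserDokchitserAnnals2010, §4.6, proof of Thm. 4.19 (= Thm. 1.4), with Lemma 4.14] [cite: Dokchitser2013ParityNotes, §4, proof of the Theorem "[Squarity, NekIV, Kurast]", first display] -/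
theorem dokchitser_selmerCorank_baseChange_mod_two_eq_iff_odd_add_quadraticTwist :
    dokchitser_selmerCorank_baseChange_mod_two_eq ↔
      ∀ (W : WeierstrassCurve ℚ) [W.IsElliptic] (p : ℕ) [Fact p.Prime], p ≠ 2 →
        ∀ (K : Type) [Field K] [NumberField K], IsImaginaryQuadratic K →
          SatisfiesHeegnerHypothesis (W.conductorNorm ℤ) K →
            Odd (W.selmerCorank p + (W.quadraticTwist (NumberField.discr K : ℚ)).selmerCorank p) := by
  refine ⟨fun h W _ p _ hp K _ _ hK hH ↦ ?_, fun h W _ p _ hp K _ _ hK hH ↦ ?_⟩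
  · rw [← selmerCorank_baseChange_quadratic_holds W K hK.1 p]
    exact Nat.odd_iff.mpr (h W p hp K hK hH)
  · rw [selmerCorank_baseChange_quadratic_holds W K hK.1 p]
    exact Nat.odd_iff.mp (h W p hp K hK hH)

/-! ### The sign of `L(E/K, s)` under the Heegner hypothesis, from modularity -/

/-- **`odd_analyticRankEK_of_satisfiesHeegnerHypothesis` from the Modularity Theorem alone.**
Assume `exists_isNewformOf` (every elliptic `E/ℚ` has a newform `f ∈ S₂(Γ₀(N_E))` with
`aₙ(f) = aₙ(E)`; Breuil–Conrad–Diamond–Taylor 2001, Thm. A, level `N_E` by Carayol 1986). Then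
for every elliptic `W/ℚ` and every imaginary quadratic `K` in which all primes dividing `N_W`
split, `ord_{s=1} L(W, s) L(W^{(d_K)}, s)` is odd: the Kronecker character `χ_{d_K}` twists `W`
into `W^{(d_K)}` with `χ_{d_K}(−1) χ_{d_K}(N_W) = −1` (`exists_twistCharacter_of_odd_discr`,
`exists_twistCharacter_of_four_dvd_discr`, according as `d_K` is odd or divisible by `4`,
`Quadratic.isFundamentalDiscriminant_discr`), and then Atkin–Lehner theory of the twisted
newform gives opposite signs in the two functional equations
(`odd_analyticRankEK_of_isNewformOf_of_cuspCoeff_twist`; Gross 1984, §5; Darmon 2004, §3.6,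
Thm. 3.15 and Thm. 3.17, and §3.9, proof of Thm. 3.22: "`L(E/K, s) = L(E, s)L(E, ε, s)`
vanishes to odd order at `s = 1`").
[cite: Darmon2004, §3.9, proof of Thm. 3.22 (printed p. 40)] [cite: Gross1984, §5] [cite: BCDTJAMS2001, Thm. A] -/
theorem odd_analyticRankEK_of_satisfiesHeegnerHypothesis_of_exists_isNewformOf
    (hmod : exists_isNewformOf) : odd_analyticRankEK_of_satisfiesHeegnerHypothesis := by
  intro W _ K _ _ hK hH
  haveI : NeZero (W.conductorNorm ℤ) := ⟨(W.conductorNorm_pos_holds).ne'⟩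
  obtain ⟨f, hf⟩ := hmod W
  obtain ⟨m, _, χ, hNm, hq, hprim, hcoeff, hsign⟩ :
      ∃ (m : ℕ) (_ : NeZero m) (χ : DirichletCharacter ℂ m), (W.conductorNorm ℤ).Coprime m ∧
        χ.IsQuadratic ∧ χ.IsPrimitive ∧
        (∀ n : ℕ, ((W.quadraticTwist (NumberField.discr K : ℚ)).LFunction n : ℂ) =
          χ n * (W.LFunction n : ℂ)) ∧
        χ (-1) * χ (W.conductorNorm ℤ) = -1 := by
    rcases Quadratic.isFundamentalDiscriminant_discr (K := K) hK.1 with ⟨hD4, -, -⟩ | ⟨h4, -, -⟩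
    · exact exists_twistCharacter_of_odd_discr W K hK hH (Int.odd_iff.mpr (by omega))
    · exact exists_twistCharacter_of_four_dvd_discr W K hK hH h4
  exact odd_analyticRankEK_of_isNewformOf_of_cuspCoeff_twist W (W.conductorNorm ℤ) K hf hNm hq
    hprim hcoeff hsign

/-! ### The converse of "it suffices to prove it for `E/M₀`" -/

/-- **Thm. 4.19 for `E` and `E^{(d_K)}`, with modularity, gives step (4) back** (the converse
direction of Dokchitser–Dokchitser 2010, §4.6, proof of Thm. 4.19: "By Kolyvagin's theorem, the
parity conjecture holds for the twist, so it suffices to prove it for `E/M₀`" — the parity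
conjecture for any two of `E/ℚ`, `E^{(d_{M₀})}/ℚ`, `E/M₀` gives it for the third). Assume the
congruence `rk_p(E'/ℚ) ≡ ord_{s=1} L(E', s) (mod 2)` (`selmerCorank_mod_two_eq E' p`, Thm. 4.19)
for every elliptic `E'/ℚ` and every prime `p` (`hpp`), and the Modularity Theorem
`exists_isNewformOf` (`hmod`). Then for every elliptic `W/ℚ`, every odd prime `p` and every
imaginary quadratic `K` in which all primes dividing `N_W` split,
`rk_p(W/K) = rk_p(W) + rk_p(W^{(d_K)})` (`selmerCorank_baseChange_quadratic_holds`)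
`≡ ord L(W) + ord L(W^{(d_K)}) = ord L(W/K)` (`analyticRankEK_eq_add_of`, entire continuation
from `hmod`) `≡ 1 (mod 2)`
(`odd_analyticRankEK_of_satisfiesHeegnerHypothesis_of_exists_isNewformOf`). In particular the
named fact `dokchitser_selmerCorank_baseChange_mod_two_eq` is a consequence of Thm. 1.4 and
modularity (the hypothesis `p ≠ 2` is not used in this direction).
[cite: DokchitserDokchitserAnnals2010, §4.6, proof of Thm. 4.19 (= Thm. 1.4)] [cite: BCDTJAMS2001, Thm. A] -/
theorem dokchitser_selmerCorank_baseChange_mod_two_eq_of_selmerCorank_mod_two_eq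
    (hmod : exists_isNewformOf)
    (hpp : ∀ (W : WeierstrassCurve ℚ) [W.IsElliptic] (p : ℕ) [Fact p.Prime],
      selmerCorank_mod_two_eq W p) :
    dokchitser_selmerCorank_baseChange_mod_two_eq := by
  intro W _ p _ _ K _ _ hK hH
  have hd : (NumberField.discr K : ℚ) ≠ 0 := by exact_mod_cast NumberField.discr_ne_zero K
  haveI := W.isElliptic_quadraticTwist hd
  have hodd : Odd (analyticRankEK W K) :=
    odd_analyticRankEK_of_satisfiesHeegnerHypothesis_of_exists_isNewformOf hmod W K hK hH
  rw [analyticRankEK_eq_add_of (hasEntireLFunction_rat_of_exists_isNewformOf hmod) W K] at hodd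
  have h₁ : W.selmerCorank p % 2 = W.analyticRank % 2 := hpp W p
  have h₂ : (W.quadraticTwist (NumberField.discr K : ℚ)).selmerCorank p % 2 =
      (W.quadraticTwist (NumberField.discr K : ℚ)).analyticRank % 2 := hpp _ p
  rw [selmerCorank_baseChange_quadratic_holds W K hK.1 p]
  obtain ⟨r, hr⟩ := hodd
  omega

/-! ### The case of analytic rank one over `M₀`: Gross–Zagier–Kolyvagin over `K` -/

/-- **Step (4) when `L'(E/M₀, 1) ≠ 0`, for every prime `p`.** If the imaginary quadratic `K`
satisfies the Heegner hypothesis for `N_W` and `L'(W/K, 1) ≠ 0`, then by Gross–Zagier and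
Kolyvagin (`mordellWeilRank_eq_one_of_LDerivEK_ne_zero W K`, hypothesis `hGZK`: `rank E(K) = 1`
and `Ш(E/K)` finite; Gross 1991, (1.1) and Thm. 1.3; Kolyvagin 1990, Thm. A) the `p^∞`-Selmer
rank is `rk_p(E/K) = rank E(K) + corank Ш(E/K)[p^∞] = 1 + 0`
(`selmerCorank_eq_mordellWeilRank_add_holds`, Greenberg 1999, §1; `shaCorank_eq_zero_of_finite`)
— in particular odd. This is the part of step (4) of Dokchitser–Dokchitser 2010, §4.6 that the
tree's Heegner-point facts cover (analytic rank one over `M₀`); the printed proof needs no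
case distinction. [cite: Gross1991, (1.1) and Thm. 1.3] [cite: DokchitserDokchitserAnnals2010, §4.6, proof of Thm. 4.19 (= Thm. 1.4)] -/
theorem selmerCorank_baseChange_eq_one_of_LDerivEK_ne_zero (W : WeierstrassCurve ℚ) [W.IsElliptic]
    [W.IsGloballyMinimal] (K : Type) [Field K] [NumberField K]
    (hGZK : mordellWeilRank_eq_one_of_LDerivEK_ne_zero W K) (hK : IsImaginaryQuadratic K)
    (hH : SatisfiesHeegnerHypothesis (W.conductorNorm ℤ) K) (hL : LDerivEK W K ≠ 0) (p : ℕ)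
    [Fact p.Prime] : (W.baseChange K).selmerCorank p = 1 := by
  haveI : NeZero (W.conductorNorm ℤ) := ⟨(W.conductorNorm_pos_holds).ne'⟩
  haveI : (W.baseChange K).IsElliptic := by rw [baseChange]; infer_instance
  obtain ⟨hrank, hsha⟩ := hGZK hK hH hL
  haveI : Finite (W.baseChange K).sha := hsha
  rw [(W.baseChange K).selmerCorank_eq_mordellWeilRank_add_holds p, hrank,
    (W.baseChange K).shaCorank_eq_zero_of_finite p, add_zero]

/-- Hence, in analytic rank one over `M₀`, the conclusion of step (4) — `rk_p(E/M₀)` odd — for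
every prime `p` (not only odd `p`), from Gross–Zagier–Kolyvagin over `K` alone.
[cite: Gross1991, (1.1) and Thm. 1.3] [cite: DokchitserDokchitserAnnals2010, §4.6, proof of Thm. 4.19 (= Thm. 1.4)] -/
theorem selmerCorank_baseChange_mod_two_eq_one_of_LDerivEK_ne_zero (W : WeierstrassCurve ℚ)
    [W.IsElliptic] [W.IsGloballyMinimal] (K : Type) [Field K] [NumberField K]
    (hGZK : mordellWeilRank_eq_one_of_LDerivEK_ne_zero W K) (hK : IsImaginaryQuadratic K)
    (hH : SatisfiesHeegnerHypothesis (W.conductorNorm ℤ) K) (hL : LDerivEK W K ≠ 0) (p : ℕ)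
    [Fact p.Prime] : (W.baseChange K).selmerCorank p % 2 = 1 := by
  rw [selmerCorank_baseChange_eq_one_of_LDerivEK_ne_zero W K hGZK hK hH hL p]

end Literature.NumberTheory.EllipticCurves

end
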